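import Mathlib
import HarnessLib
import Summits.Ventures.LatticeQCDFlow.Scoring.KArmHomogeneityLocalPower
import Summits.Ventures.LatticeQCDFlow.Scoring.GaussianShiftedBallThreshold

/-!
# WHICH LOCAL ALTERNATIVES THE `k`-ARM HOMOGENEITY TEST DETECTS: THE LIMITING ACCEPTANCE
# PROBABILITY IS STRICTLY BELOW THE NOMINAL ONE IFF THE DRIFTS `h_r` ARE NOT ALL EQUAL; A DRIFT
# COMMON TO ALL CODES IS INVISIBLE

HONEST FRAMING: exact (Metropolis-corrected) sampling algorithms for lattice gauge theory;
figures of merit are autocorrelation/cost numbers at stated couplings and volumes; no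
continuum-physics claim.

Venture `LatticeQCDFlow` (cell pub-lqcd), topic `Scoring`; FANOUT row 4 (`s0-u1-b`, GEN-34).
NEW WORK of the cell (classical), no definition, nothing cited as a fact.

WHY (row 4).  `Scoring/KArmHomogeneityLocalPower` gives the limiting acceptance probability of the
one-shot `k`-arm test under centres `a + h_r/√n` as the shifted-ball probability `F_c(κ)`,
`κ² = Σ_r (h_r − h̄_w)²/s_r`; `Scoring/GaussianShiftedBallThreshold` shows `F_c` is STRICTLY
decreasing on `[0, ∞)` (`c > 0`).  Consequences recorded here, because they say exactly what a
multi-implementation comparison can and cannot certify: (i) `κ = 0` iff all drifts are equal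
(**`noncentrality_sq_eq_zero_iff`**) — in particular a bias COMMON to every implementation
(all codes wrong by the same amount) leaves the limit at its nominal value
(**`kArm_homogeneity_localPower_of_common_drift`**): agreement between codes is evidence of
equality of their targets, never of correctness; (ii) as soon as two drifts differ and `c > 0`, the
limiting acceptance probability is STRICTLY below the nominal one
(**`kArm_homogeneity_localPower_lt_null`**) — the test has non-trivial power against every
genuinely heterogeneous local alternative; (iii) for every target `β` strictly between `0` and the
nominal acceptance probability there is exactly one non-centrality `κ_β > 0` achieving it
(**`kArm_detectable_noncentrality_existsUnique`**, from the threshold theorem); (iv) more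
heterogeneity (larger `Σ_r (h_r − h̄_w)²/s_r`) means a smaller limiting acceptance probability,
strictly for `c > 0` (**`kArm_homogeneity_localPower_mono_noncentrality`**, **`…_strictAnti_…`**).

NOT CLAIMED: the numerical value of `κ_β`; rates; anything re-scored.
-/

open MeasureTheory ProbabilityTheory Filter Topology Finset

namespace Summit.Ventures.LatticeQCDFlow.Scoring

open Set

/-! ## §1 When is the non-centrality zero? -/

section Noncentrality

variable {R : ℕ}

/-- **`κ² = Σ_r (h_r − h̄_w)²/s_r = 0` iff every drift equals the weighted mean** (`s_r > 0`). [ours] -/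
theorem noncentrality_sq_eq_zero_iff (h s : Fin R → ℝ) (hs : ∀ r, 0 < s r) :
    ∑ r, (h r - (∑ j, h j / s j) / (∑ j, (s j)⁻¹)) ^ 2 / s r = 0
      ↔ ∀ r, h r = (∑ j, h j / s j) / (∑ j, (s j)⁻¹) := by
  rw [Finset.sum_eq_zero_iff_of_nonneg fun r _ => div_nonneg (sq_nonneg _) (hs r).le]
  simp only [Finset.mem_univ, true_implies, div_eq_zero_iff, (hs _).ne', or_false,
    pow_eq_zero_iff two_ne_zero, sub_eq_zero]

/-- If all drifts are equal, the non-centrality vanishes (`R ≥ 1`). [ours] -/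
theorem noncentrality_sq_eq_zero_of_const [NeZero R] {h : Fin R → ℝ} (s : Fin R → ℝ)
    (hs : ∀ r, 0 < s r) {d : ℝ} (hh : ∀ r, h r = d) :
    ∑ r, (h r - (∑ j, h j / s j) / (∑ j, (s j)⁻¹)) ^ 2 / s r = 0 := by
  have hW : (∑ j, (s j)⁻¹) ≠ 0 :=
    (Finset.sum_pos (fun j _ => inv_pos.2 (hs j)) Finset.univ_nonempty).ne'
  have hmean : (∑ j, h j / s j) / (∑ j, (s j)⁻¹) = d := by
    rw [div_eq_iff hW, Finset.mul_sum]
    refine Finset.sum_congr rfl fun j _ => ?_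
    rw [hh j, div_eq_mul_inv]
  refine Finset.sum_eq_zero fun r _ => ?_
  rw [hmean, hh r, sub_self, zero_pow two_ne_zero, zero_div]

/-- If two drifts differ, the non-centrality is positive. [ours] -/
theorem noncentrality_sq_pos_of_ne {h : Fin R → ℝ} (s : Fin R → ℝ) (hs : ∀ r, 0 < s r)
    {r₁ r₂ : Fin R} (hne : h r₁ ≠ h r₂) :
    0 < ∑ r, (h r - (∑ j, h j / s j) / (∑ j, (s j)⁻¹)) ^ 2 / s r := by
  have hnn : 0 ≤ ∑ r, (h r - (∑ j, h j / s j) / (∑ j, (s j)⁻¹)) ^ 2 / s r :=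
    Finset.sum_nonneg fun r _ => div_nonneg (sq_nonneg _) (hs r).le
  rcases hnn.lt_or_eq with hlt | heq
  · exact hlt
  · exfalso
    have hall := (noncentrality_sq_eq_zero_iff h s hs).1 heq.symm
    exact hne ((hall r₁).trans (hall r₂).symm)

end Noncentrality

/-! ## §2 Consequences for the local power -/

section Consequences

variable {n : ℕ} {Ωs : Fin (n + 2) → Type*} [∀ r, MeasurableSpace (Ωs r)]
  {Ps : (r : Fin (n + 2)) → Measure (Ωs r)} [∀ r, IsProbabilityMeasure (Ps r)]
variable {Ω' : Type*} [MeasurableSpace Ω'] {P' : Measure Ω'} [IsProbabilityMeasure P']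

/-- **A COMMON DRIFT IS INVISIBLE**: if every code's CLT is centred at the SAME drift `d`
(`√k(Sₖ^r − a) ⇒ N(d, s_r)` for all `r`), the acceptance probability of the `k`-arm test tends to
the NOMINAL value `N^{⊗R}{Σ_{r≠0} z_r² ≤ c}` — exactly as under the null.  Agreement between
implementations certifies equality of their targets, not their correctness. [ours] -/
theorem kArm_homogeneity_localPower_of_common_drift {S V : (r : Fin (n + 2)) → ℕ → Ωs r → ℝ}
    {a d : ℝ} {s : Fin (n + 2) → ℝ} {Z : Fin (n + 2) → Ω' → ℝ} (hs : ∀ r, 0 < s r)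
    (hSm : ∀ r k, Measurable (S r k)) (hVm : ∀ r k, Measurable (V r k))
    (hclt : ∀ r, TendstoInDistribution (fun (k : ℕ) ω => Real.sqrt k * (S r k ω - a)) atTop (Z r)
      (fun _ => Ps r) P')
    (hZm : ∀ r, Measurable (Z r)) (hZ : ∀ r, HasLaw (Z r) (gaussianReal d (s r).toNNReal) P')
    (hind : iIndepFun Z P')
    (hV : ∀ r, ∀ᵐ ω ∂(Ps r), Tendsto (fun k : ℕ => (k : ℝ) * V r k ω) atTop (𝓝 (s r))) (c : ℝ) :
    Tendsto (fun k : ℕ => (Measure.pi Ps).real {ω : (r : Fin (n + 2)) → Ωs r |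
        ∑ r, (S r k (ω r) - (∑ j, S j k (ω j) / V j k (ω j)) / (∑ j, (V j k (ω j))⁻¹)) ^ 2
          / V r k (ω r) ≤ c})
      atTop (𝓝 ((Measure.pi fun _ : Fin (n + 2) => gaussianReal 0 1).real
        {z : Fin (n + 2) → ℝ | ∑ r ∈ univ.erase 0, z r ^ 2 ≤ c})) := by
  have hconv := kArm_homogeneity_localPower (h := fun _ => d) hs hSm hVm hclt hZm hZ hind hV c
  rw [noncentrality_sq_eq_zero_of_const s hs (fun r => rfl), Real.sqrt_zero,
    shiftedBall_zero_eq_erase (zero_ne_one : (0 : Fin (n + 2)) ≠ 1)] at hconv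
  exact hconv

/-- **EVERY HETEROGENEOUS LOCAL ALTERNATIVE IS DETECTED WITH NON-TRIVIAL PROBABILITY**: if two
drifts differ and `c > 0`, the limiting acceptance probability is STRICTLY below the nominal one. [ours] -/
theorem kArm_homogeneity_localPower_lt_null {h : Fin (n + 2) → ℝ} (s : Fin (n + 2) → ℝ)
    (hs : ∀ r, 0 < s r) {r₁ r₂ : Fin (n + 2)} (hne : h r₁ ≠ h r₂) {c : ℝ} (hc : 0 < c) :
    (Measure.pi fun _ : Fin (n + 2) => gaussianReal 0 1).real
        {z : Fin (n + 2) → ℝ | (z 1 + Real.sqrt (∑ r, (h r - (∑ j, h j / s j) / (∑ j, (s j)⁻¹)) ^ 2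
            / s r)) ^ 2 + ∑ r ∈ (univ.erase 0).erase 1, z r ^ 2 ≤ c}
      < (Measure.pi fun _ : Fin (n + 2) => gaussianReal 0 1).real
        {z : Fin (n + 2) → ℝ | ∑ r ∈ univ.erase 0, z r ^ 2 ≤ c} := by
  have hκ : 0 < Real.sqrt (∑ r, (h r - (∑ j, h j / s j) / (∑ j, (s j)⁻¹)) ^ 2 / s r) :=
    Real.sqrt_pos.2 (noncentrality_sq_pos_of_ne s hs hne)
  have hlt := pi_gaussianReal_shiftedBall_strictAntiOn (ι := Fin (n + 2)) 0 1 hc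
    (Set.mem_Ici.2 (le_refl (0 : ℝ))) (Set.mem_Ici.2 hκ.le) hκ
  rw [← shiftedBall_zero_eq_erase (zero_ne_one : (0 : Fin (n + 2)) ≠ 1) c]
  exact hlt

/-- **MORE HETEROGENEITY, MORE POWER**: if two drift configurations `h, h'` satisfy
`Σ_r (h_r − h̄_w)²/s_r ≤ Σ_r (h'_r − h̄'_w)²/s_r`, the limiting acceptance probability under `h'` is
at most the one under `h` (every `c`). [ours] -/
theorem kArm_homogeneity_localPower_mono_noncentrality (h h' s : Fin (n + 2) → ℝ)
    (hle : ∑ r, (h r - (∑ j, h j / s j) / (∑ j, (s j)⁻¹)) ^ 2 / s r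
      ≤ ∑ r, (h' r - (∑ j, h' j / s j) / (∑ j, (s j)⁻¹)) ^ 2 / s r) (c : ℝ) :
    (Measure.pi fun _ : Fin (n + 2) => gaussianReal 0 1).real
        {z : Fin (n + 2) → ℝ | (z 1 + Real.sqrt (∑ r, (h' r - (∑ j, h' j / s j) / (∑ j, (s j)⁻¹)) ^ 2
            / s r)) ^ 2 + ∑ r ∈ (univ.erase 0).erase 1, z r ^ 2 ≤ c}
      ≤ (Measure.pi fun _ : Fin (n + 2) => gaussianReal 0 1).real
        {z : Fin (n + 2) → ℝ | (z 1 + Real.sqrt (∑ r, (h r - (∑ j, h j / s j) / (∑ j, (s j)⁻¹)) ^ 2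
            / s r)) ^ 2 + ∑ r ∈ (univ.erase 0).erase 1, z r ^ 2 ≤ c} :=
  pi_gaussianReal_shiftedBall_antitoneOn (ι := Fin (n + 2)) 0 1 c
    (Set.mem_Ici.2 (Real.sqrt_nonneg _)) (Set.mem_Ici.2 (Real.sqrt_nonneg _))
    (Real.sqrt_le_sqrt hle)

/-- **STRICTLY more power** for strictly larger non-centrality (`c > 0`, `s_r > 0`). [ours] -/
theorem kArm_homogeneity_localPower_strictAnti_noncentrality (h h' s : Fin (n + 2) → ℝ)
    (hs : ∀ r, 0 < s r)
    (hlt : ∑ r, (h r - (∑ j, h j / s j) / (∑ j, (s j)⁻¹)) ^ 2 / s r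
      < ∑ r, (h' r - (∑ j, h' j / s j) / (∑ j, (s j)⁻¹)) ^ 2 / s r) {c : ℝ} (hc : 0 < c) :
    (Measure.pi fun _ : Fin (n + 2) => gaussianReal 0 1).real
        {z : Fin (n + 2) → ℝ | (z 1 + Real.sqrt (∑ r, (h' r - (∑ j, h' j / s j) / (∑ j, (s j)⁻¹)) ^ 2
            / s r)) ^ 2 + ∑ r ∈ (univ.erase 0).erase 1, z r ^ 2 ≤ c}
      < (Measure.pi fun _ : Fin (n + 2) => gaussianReal 0 1).real
        {z : Fin (n + 2) → ℝ | (z 1 + Real.sqrt (∑ r, (h r - (∑ j, h j / s j) / (∑ j, (s j)⁻¹)) ^ 2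
            / s r)) ^ 2 + ∑ r ∈ (univ.erase 0).erase 1, z r ^ 2 ≤ c} := by
  have hnn : 0 ≤ ∑ r, (h r - (∑ j, h j / s j) / (∑ j, (s j)⁻¹)) ^ 2 / s r :=
    Finset.sum_nonneg fun r _ => div_nonneg (sq_nonneg _) (hs r).le
  exact pi_gaussianReal_shiftedBall_strictAntiOn (ι := Fin (n + 2)) 0 1 hc
    (Set.mem_Ici.2 (Real.sqrt_nonneg _)) (Set.mem_Ici.2 (Real.sqrt_nonneg _))
    (Real.sqrt_lt_sqrt hnn hlt)

/-- **THE DETECTABLE NON-CENTRALITY**: for `c > 0` and every target acceptance probability `β`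
strictly between `0` and the nominal one, there is exactly one `κ ≥ 0` at which the limiting
acceptance probability of the `k`-arm test equals `β` (and it is positive). [ours] -/
theorem kArm_detectable_noncentrality_existsUnique {c β : ℝ} (hc : 0 < c) (hβ0 : 0 < β)
    (hβ1 : β < (Measure.pi fun _ : Fin (n + 2) => gaussianReal 0 1).real
      {z : Fin (n + 2) → ℝ | ∑ r ∈ univ.erase 0, z r ^ 2 ≤ c}) :
    ∃! κ : ℝ, 0 ≤ κ ∧ (Measure.pi fun _ : Fin (n + 2) => gaussianReal 0 1).real
      {z : Fin (n + 2) → ℝ | (z 1 + κ) ^ 2 + ∑ r ∈ (univ.erase 0).erase 1, z r ^ 2 ≤ c} = β := by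
  rw [← shiftedBall_zero_eq_erase (zero_ne_one : (0 : Fin (n + 2)) ≠ 1) c] at hβ1
  exact pi_gaussianReal_shiftedBall_threshold_existsUnique 0 1 hc hβ0 hβ1

end Consequences

end Summit.Ventures.LatticeQCDFlow.Scoring
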